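import Literature.Probability.RandomPlanarGeometry.HexSAWBrickWallKestenRelation
import Literature.Probability.Process.RenewalTheorem
import HarnessLib

/-!
# The critical brick-wall bridge sequence of the hexagonal lattice converges: `b_n(ℍ) μ_ℍ^{-n} → L`

Topic `Literature/Probability/RandomPlanarGeometry` (continues `HexSAWBrickWallKestenRelation.lean`: Kesten's relation
`HexBW.kestenRelation` for brick-wall bridges, the renewal equation `HexBW.bridgeCount_eq_sum_range`,
`HexBW.bridgeCount_le_pow`, `λ_0 = 0 < λ_1`).  Lane «pcv-sawmu», door R87b «HEX-BW-BRIDGE-LIMIT».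

By Kesten's relation the sequence `u_n = b_n(ℍ) μ_ℍ^{-n}` is an aperiodic (`f_1 = λ_1(ℍ)/μ_ℍ > 0`) recurrent renewal
sequence with weights `f_k = λ_k(ℍ) μ_ℍ^{-k}`, so the discrete renewal theorem (Erdős–Feller–Pollard; Madras–Slade
Theorem 4.2.2 (b), tree `Renewal.tendsto_of_summable_mul` / `Renewal.tendsto_zero_of_not_summable_mul`) gives
`u_n → 1/Σ_k k f_k` (finite mean) or `u_n → 0` (infinite mean); in either case the limit EXISTS.  Which case holds in
the brick-wall frame is not decided IN THIS FILE (in the strip frame of Duminil-Copin–Smirnov the mean is infinite: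
Beaton et al. 2014, Theorem 10 / Lemma 11; tree `HV.not_summable_width_mul_stripIlim`).  In the present perpendicular
frame there is a PRINTED INPUT: for the honeycomb lattice "oriented so that it contains horizontal edges" Beaton 2014
(Appendix, Theorem 14) proves `lim_{T→∞} PP_T(x_c) = 0` for his "PP-bridges" (a sub-class of the present bridges, by
height) by the stick-breaking argument of Duminil-Copin–Hammond, and (Lemma 16) "Theorem 14 is equivalent to
`E_iSAPP(H(γ)) = ∞`"; from it `L = 0` follows by `tendsto_bridgeCount_div_pow_zero_of_not_summable` below once Beaton's
PP-bridges are matched with `HexBW.bridges` — done, conditionally on the named printed fact `HexBW.Beaton2014Thm14`, in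
`HexSAWBrickWallBridgeNullBeaton.lean` (`HexBW.tendsto_bridgeCount_div_pow_zero_of_beaton`; Kesten's relation by span is
`HexSAWBrickWallSpanRenewal.lean`); not in this file.

Status in print: for `ℤ^d` the existence of `lim b_N μ^{-N}` is Madras–Slade's consequence of Theorem 4.2.2 (p. 92)
and the value `0` is Duminil-Copin–Hammond 2013, Theorem 2.5 (tree `Zd.tendsto_bridgeCount_div_pow_zero`); for the
honeycomb lattice in this frame only Beaton's height statement above is printed — the by-length statements below are
not.  First text; `L = 0` is not derived here (printed input: Beaton 2014, Theorem 14; conditional derivation in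
`HexSAWBrickWallBridgeNullBeaton.lean`).
[cite: Beaton2014RotatedHoneycomb, Appendix, Theorem 14 and Lemma 16 (arXiv:1210.0274v3, pp. 19–20)]
-/

noncomputable section

open Filter Topology Finset

namespace Literature.Probability.RandomPlanarGeometry.SAW

namespace HexBW

/-- The renewal-sequence data of the brick-wall bridges at criticality: `u_0 = 1`, `0 ≤ u_n ≤ 1`, `f_k ≥ 0`, `f_0 = 0`,
the renewal equation, `Σ f_k = 1` (Kesten's relation) and `f_1 > 0`. [cite: MadrasSlade1993, §4.2, eqs. (4.2.2)–(4.2.4) (pp. 90–91)] -/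
private theorem renewal_data :
    (fun n : ℕ => (bridgeCount n : ℝ) / hexConnectiveConstant ^ n) 0 = 1 ∧
    (∀ n, 0 ≤ (fun n : ℕ => (bridgeCount n : ℝ) / hexConnectiveConstant ^ n) n) ∧
    (∀ n, (fun n : ℕ => (bridgeCount n : ℝ) / hexConnectiveConstant ^ n) n ≤ 1) ∧
    (∀ k, 0 ≤ (fun k : ℕ => (irreducibleBridgeCount k : ℝ) / hexConnectiveConstant ^ k) k) ∧
    (fun k : ℕ => (irreducibleBridgeCount k : ℝ) / hexConnectiveConstant ^ k) 0 = 0 ∧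
    (∀ n, 1 ≤ n → (fun n : ℕ => (bridgeCount n : ℝ) / hexConnectiveConstant ^ n) n =
      ∑ k ∈ range (n + 1), (fun k : ℕ => (irreducibleBridgeCount k : ℝ) / hexConnectiveConstant ^ k) k *
        (fun n : ℕ => (bridgeCount n : ℝ) / hexConnectiveConstant ^ n) (n - k)) ∧
    0 < (fun k : ℕ => (irreducibleBridgeCount k : ℝ) / hexConnectiveConstant ^ k) 1 := by
  have hμ : 0 < hexConnectiveConstant := hexConnectiveConstant_pos
  refine ⟨by simp [bridgeCount_zero], fun n => by positivity,
    fun n => (div_le_one (pow_pos hμ n)).2 (bridgeCount_le_pow n), fun k => by positivity,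
    by simp [irreducibleBridgeCount_zero], fun n hn => ?_, ?_⟩
  · dsimp only
    rw [bridgeCount_eq_sum_range hn, sum_div]
    refine sum_congr rfl fun k hk => ?_
    have hkn : k ≤ n := Nat.lt_succ_iff.1 (mem_range.1 hk)
    rw [div_mul_div_comm, ← pow_add, Nat.add_sub_cancel' hkn]
  · have h1 : (0 : ℝ) < irreducibleBridgeCount 1 := by exact_mod_cast irreducibleBridgeCount_one_pos
    positivity

/-- **Positive-recurrent case**: if the critical irreducible brick-wall bridges have finite mean length,
`Σ_k k λ_k(ℍ) μ_ℍ^{-k} < ∞`, then `b_n(ℍ) μ_ℍ^{-n} → 1 / Σ_k k λ_k(ℍ) μ_ℍ^{-k}` (renewal theorem, finite mean).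
[cite: MadrasSlade1993, Theorem 4.2.2 (b) (p. 91) and its consequence for bridges (p. 92)] -/
theorem tendsto_bridgeCount_div_pow_of_summable
    (hmean : Summable fun k : ℕ => (k : ℝ) * ((irreducibleBridgeCount k : ℝ) / hexConnectiveConstant ^ k)) :
    Tendsto (fun n : ℕ => (bridgeCount n : ℝ) / hexConnectiveConstant ^ n) atTop
      (𝓝 (∑' k : ℕ, (k : ℝ) * ((irreducibleBridgeCount k : ℝ) / hexConnectiveConstant ^ k))⁻¹) := by
  obtain ⟨hu0, hu, hu1, hf, hf0, hren, hf1pos⟩ := renewal_data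
  exact _root_.Literature.Probability.Process.Renewal.tendsto_of_summable_mul hu0 hu hu1 hf hf0 hren
    kestenRelation hf1pos hmean

/-- **Null-recurrent case**: if the critical irreducible brick-wall bridges have infinite mean length, then
`b_n(ℍ) μ_ℍ^{-n} → 0` (renewal theorem, infinite mean). [cite: MadrasSlade1993, Theorem 4.2.2 (b) (p. 91) and its consequence for bridges (p. 92)] -/
theorem tendsto_bridgeCount_div_pow_zero_of_not_summable
    (hmean : ¬ Summable fun k : ℕ => (k : ℝ) * ((irreducibleBridgeCount k : ℝ) / hexConnectiveConstant ^ k)) :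
    Tendsto (fun n : ℕ => (bridgeCount n : ℝ) / hexConnectiveConstant ^ n) atTop (𝓝 0) := by
  obtain ⟨hu0, hu, hu1, hf, hf0, hren, hf1pos⟩ := renewal_data
  exact _root_.Literature.Probability.Process.Renewal.tendsto_zero_of_not_summable_mul hu0 hu hu1 hf hf0 hren
    kestenRelation hf1pos hmean

/-- **`b_n(ℍ) μ_ℍ^{-n}` converges** (brick-wall bridges of the hexagonal lattice at criticality): there is `L` (namely
`1/Σ_k k λ_k(ℍ) μ_ℍ^{-k}`, read as `0` when the mean is infinite) with `b_N(ℍ)/μ_ℍ^N → L` — Kesten's relation makes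
`b_n μ^{-n}` an aperiodic recurrent renewal sequence (`λ_1(ℍ) = 1 > 0`), and the renewal theorem applies.  Whether
`L = 0` in this frame is not decided here (printed input for it: Beaton 2014, Appendix, Theorem 14 / Lemma 16 — see the
module docstring; conditional derivation `HexBW.tendsto_bridgeCount_div_pow_zero_of_beaton` in
`HexSAWBrickWallBridgeNullBeaton.lean`). [cite: MadrasSlade1993, Theorem 4.2.2 (b) (p. 91) and p. 92 ("lim_{N→∞} b_N μ^{-N} exists")] -/
theorem exists_tendsto_bridgeCount_div_pow :
    ∃ L : ℝ, Tendsto (fun N : ℕ => (bridgeCount N : ℝ) / hexConnectiveConstant ^ N) atTop (𝓝 L) := by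
  by_cases hmean : Summable fun k : ℕ => (k : ℝ) * ((irreducibleBridgeCount k : ℝ) / hexConnectiveConstant ^ k)
  · exact ⟨_, tendsto_bridgeCount_div_pow_of_summable hmean⟩
  · exact ⟨0, tendsto_bridgeCount_div_pow_zero_of_not_summable hmean⟩

end HexBW

end Literature.Probability.RandomPlanarGeometry.SAW
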